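import Mathlib
import Summits.ValiantsHypothesis.ValiantsHypothesis.Theorems.NewtonUnitEquationsTwoProductsFormalLogLinearisationLiftedNecessity
import Summits.ValiantsHypothesis.ValiantsHypothesis.Theorems.NewtonUnitEquationsTwoProductsFormalLogLinearisationLiftedHyperbolicCross
import Summits.ValiantsHypothesis.ValiantsHypothesis.Theorems.NewtonUnitEquationsTwoProductsFormalLogLinearisationLiftedSlotRank
import Summits.ValiantsHypothesis.ValiantsHypothesis.Theorems.NewtonUnitEquationsTwoProductsFormalLogLinearisationLiftedOverlapPencil
import Summits.ValiantsHypothesis.ValiantsHypothesis.Theorems.NewtonUnitEquationsTwoProductsFormalLogLinearisationEngineCommonConeLattice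
import Summits.ValiantsHypothesis.ValiantsHypothesis.Theorems.NewtonUnitEquationsTwoProductsPlanarCrossCount
import HarnessLib

/-!
# Planar rungs of line `planar_cell` (val-idea-8 g0), part A′: fibre sums and `planarCross_local` (over p3 g13's landed `PlanarCell.lam` / `tailSupport`, p600642)

`planarCross_local`: for tails `u, v` (zero constant terms, ANY sparsity), an injective enumeration `E` of the tail
support, and a point `l` that is the strict `ξ`-top of `supp D` (`D = Σ log(1+u_j) − Σ log(1+v_j)`; `ξ` arbitrary —
validity is not even needed), IF the exponent map `Λ_E` is injective on the ZONE `{μ : wt ξ l ≤ wt ξ (Λ_E μ)}` (no additive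
coincidence of `E` at or above the level of `l`), THEN `l = Λ_E μ` with `∏ (μ_i + 1) ≤ 2m` — the body of `PlanarCross`
with `c = 1` (value `2m ≤ (2m)^1`).  Proof: on the zone every fibre is a singleton, so the planar log-coefficient is
`lcoef(μ)·G(μ)` with `lcoef(μ) = (−1)^{|μ|+1}(|μ|−1)!·multinomial ≠ 0` (`logDiff_eq_lifted_sum`, p586149-family), hence the
unique preimage of `l` is a strict lifted minimiser of `{G ≠ 0}` for the grading `θ_i = −wt ξ E_i`, and
`unequalMoment_hyperbolicCross` (p591055-family) applies.  This is the DISSOCIATED calibration of the line card made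
kernel-checked: SUB₁'s entire content is the behaviour AT additive coincidences.
`planarSlotBound_local` / `planarSlotBound_charged`: the SUB₂ body with value `2m` when `Λ_E` is injective on the member's zone, resp.
(sharpest form) when only the fibres the slot matrix actually reads — at each `rep d` and at each slot-shift
`(rep d ∖ slot) + e·e_{d'}`, `d' ∈ D` — are singletons.  COROLLARY (stated, immediate): for an arbitrary slot family,
`#D ≤ 2m + #{coincidence-touched members}` — the t-free content of SUB₂ is exactly `2m`; all further multiplicity is carried by
additive coincidences of the tail support (val-lit p3 g13's ghost-pair staircase, RULING #131, touches every column: SUB₂ as a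
t-free statement is FALSE, and this file says precisely what the refutation exploits).
Honest frame: rungs/structure theorems; SUB₂ REFUTED (p3), SUB₁/PlanarCellBound/crux OPEN; VP ≠ VNP not moved.
-/

set_option linter.dupNamespace false
set_option linter.unusedSectionVars false
set_option linter.style.longFile 0

noncomputable section

open scoped BigOperators
open MvPolynomial
open Summit.ValiantsHypothesis.ValiantsHypothesis.Theorems.NewtonUnitEquations.TwoProducts.FormalLogLinearisation
open Summit.ValiantsHypothesis.ValiantsHypothesis.Theorems.NewtonUnitEquations.TwoProducts.PlanarCell

namespace Summit.ValiantsHypothesis.ValiantsHypothesis.Theorems.NewtonUnitEquations.TwoProducts.PlanarCellRung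

variable {m : ℕ}

/-! ## Copies of the line's elementary objects (verbatim from `Lines/planar_cell.lean`, so that this rung file is
self-contained — the Lines module is a workfile, not a built import) -/

-- `lam`, `tailSupport`, `wt_sum`, `wt_lam`, `lam_add_single` are p3 g13's landed `…TwoProducts.PlanarCell` decls (p600642) — not restated.



-- `wt_add` is `FormalLogLinearisation.wt_add` (Tame file, in scope via the imports) — not restated.

-- `wt_nsmul` is `FormalLogLinearisation.wt_nsmul` (in scope via the imports) — not restated.





/-- The unequal-moment function `G(μ) = Σ_j A_j^μ − Σ_j B_j^μ`. -/
def umom {s : ℕ} (A B : Fin m → Fin s → ℂ) (μ : Fin s → ℕ) : ℂ :=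
  (∑ j, ∏ i, A j i ^ μ i) - (∑ j, ∏ i, B j i ^ μ i)

/-- The scalar attached to a multi-index in the formal logarithm: `(−1)^{|k|+1}/|k| · multinomial(k)`. -/
def lcoef {s : ℕ} (k : Fin s → ℕ) : ℂ :=
  (-1 : ℂ) ^ ((∑ i, k i) + 1) / ((∑ i, k i : ℕ) : ℂ) * (Nat.multinomial Finset.univ k : ℂ)

/-- The unequal-moment function vanishes at the zero multi-index (`m − m = 0`). -/
theorem umom_zero {s : ℕ} (A B : Fin m → Fin s → ℂ) : umom A B 0 = 0 := by
  simp [umom]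

/-- The formal-log scalar of a nonzero multi-index is nonzero. -/
theorem lcoef_ne_zero {s : ℕ} (k : Fin s → ℕ) (hk : k ≠ 0) : lcoef k ≠ 0 := by
  have hpos : 0 < ∑ i, k i := by
    obtain ⟨i, hi⟩ : ∃ i, k i ≠ 0 := by
      by_contra h
      push Not at h
      exact hk (funext h)
    exact lt_of_lt_of_le (Nat.pos_of_ne_zero hi) (Finset.single_le_sum (fun j _ => Nat.zero_le (k j)) (Finset.mem_univ i))
  unfold lcoef
  refine mul_ne_zero (div_ne_zero (pow_ne_zero _ (by norm_num)) ?_) ?_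
  · exact_mod_cast hpos.ne'
  · exact_mod_cast (Nat.multinomial_pos Finset.univ k).ne'

/-- A polynomial whose support lies in the range of an injective enumeration is the sum of its monomials along it. -/
theorem eq_sum_monomial_coeff {s : ℕ} (E : Fin s → Expo) (hE : Function.Injective E)
    (p : MvPolynomial (Fin 2) ℂ) (hp : (↑p.support : Set Expo) ⊆ Set.range E) :
    p = ∑ i, monomial (E i) (coeff (E i) p) := by
  classical
  ext n
  simp only [coeff_sum, coeff_monomial]
  by_cases hn : n ∈ Set.range E
  · obtain ⟨i₀, rfl⟩ := hn
    rw [Finset.sum_eq_single i₀]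
    · simp
    · intro i _ hi
      rw [if_neg (hE.ne hi)]
    · intro h; exact absurd (Finset.mem_univ _) h
  · have h0 : coeff n p = 0 := by
      by_contra h
      exact hn (hp (by simpa [mem_support_iff] using h))
    rw [h0, eq_comm]
    refine Finset.sum_eq_zero fun i _ => ?_
    rw [if_neg]
    rintro rfl
    exact hn ⟨i, rfl⟩

/-- `lam E k` is the `Σ k_i • E_i` of the lifted-sum formula. -/
theorem lam_eq_sum {s : ℕ} (E : Fin s → Expo) (k : Fin s → ℕ) : (∑ i, k i • E i) = lam E k := rfl

/-- The fibre-sum formula for the planar log-coefficients of tails supported on `range E`. -/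
theorem logDiff_eq_fibreSum {s : ℕ} (E : Fin s → Expo) (hE : Function.Injective E)
    (u v : Fin m → MvPolynomial (Fin 2) ℂ)
    (hu : ∀ j, (↑(u j).support : Set Expo) ⊆ Set.range E) (hv : ∀ j, (↑(v j).support : Set Expo) ⊆ Set.range E)
    (n : Expo) :
    logDiff u v n = ∑ r ∈ Finset.Icc 1 (n 0 + n 1), ∑ k ∈ (Finset.univ : Finset (Fin s)).piAntidiag r,
        (if lam E k = n then (-1 : ℂ) ^ (r + 1) / (r : ℂ) * (Nat.multinomial Finset.univ k : ℂ) else 0) *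
          umom (fun j i => coeff (E i) (u j)) (fun j i => coeff (E i) (v j)) k := by
  have hu' : u = fun j => ∑ i, monomial (E i) (coeff (E i) (u j)) :=
    funext fun j => eq_sum_monomial_coeff E hE (u j) (hu j)
  have hv' : v = fun j => ∑ i, monomial (E i) (coeff (E i) (v j)) :=
    funext fun j => eq_sum_monomial_coeff E hE (v j) (hv j)
  have h := logDiff_eq_lifted_sum E (fun j i => coeff (E i) (u j)) (fun j i => coeff (E i) (v j)) n
  rw [← hu', ← hv'] at h
  rw [h]
  rfl

/-- Length is at most planar degree when no `E_i` is zero. -/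
theorem sum_le_deg {s : ℕ} (E : Fin s → Expo) (hE0 : ∀ i, E i ≠ 0) (k : Fin s → ℕ) :
    ∑ i, k i ≤ (lam E k) 0 + (lam E k) 1 := by
  have h1 : ∀ i, 1 ≤ (E i) 0 + (E i) 1 := fun i => by
    by_contra h
    push Not at h
    apply hE0 i
    ext a
    fin_cases a <;> simp <;> omega
  have : (lam E k) 0 + (lam E k) 1 = ∑ i, k i * ((E i) 0 + (E i) 1) := by
    simp only [lam, Finsupp.coe_finsetSum, Finset.sum_apply, Finsupp.coe_smul, Pi.smul_apply, smul_eq_mul]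
    rw [← Finset.sum_add_distrib]
    exact Finset.sum_congr rfl fun i _ => by ring
  rw [this]
  exact Finset.sum_le_sum fun i _ => by nlinarith [h1 i]

/-- Pointwise form: if the fibre of `Λ_E μ` is the singleton `{μ}` (`μ ≠ 0`), the planar log-coefficient sum at `Λ_E μ`
collapses to `lcoef(μ)·G(μ)`. -/
theorem fibreSum_eq_single' {s : ℕ} (E : Fin s → Expo) (hE0 : ∀ i, E i ≠ 0) (G : (Fin s → ℕ) → ℂ) (μ : Fin s → ℕ)
    (hfib : ∀ k : Fin s → ℕ, lam E k = lam E μ → k = μ) (hμ0 : μ ≠ 0) :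
    (∑ r ∈ Finset.Icc 1 ((lam E μ) 0 + (lam E μ) 1), ∑ k ∈ (Finset.univ : Finset (Fin s)).piAntidiag r,
        (if lam E k = lam E μ then (-1 : ℂ) ^ (r + 1) / (r : ℂ) * (Nat.multinomial Finset.univ k : ℂ) else 0) * G k)
      = lcoef μ * G μ := by
  classical
  have hpos : 1 ≤ ∑ i, μ i := by
    obtain ⟨i, hi⟩ : ∃ i, μ i ≠ 0 := by
      by_contra h
      push Not at h
      exact hμ0 (funext h)
    exact le_trans (Nat.one_le_iff_ne_zero.mpr hi)
      (Finset.single_le_sum (fun j _ => Nat.zero_le (μ j)) (Finset.mem_univ i))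
  rw [Finset.sum_eq_single (∑ i, μ i)]
  · rw [Finset.sum_eq_single μ]
    · simp [lcoef]
    · intro k hk hne
      rw [if_neg (fun h => hne (hfib k h)), zero_mul]
    · intro h
      exact absurd (by simp [Finset.mem_piAntidiag]) h
  · intro r _ hr
    refine Finset.sum_eq_zero fun k hk => ?_
    have hks : ∑ i, k i = r := by simpa [Finset.mem_piAntidiag] using hk
    rw [if_neg, zero_mul]
    intro h
    have := hfib k h
    subst this
    exact hr hks.symm
  · intro h
    exact absurd (Finset.mem_Icc.mpr ⟨hpos, sum_le_deg E hE0 μ⟩) h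

/-- SINGLETON FIBRES COLLAPSE THE FIBRE SUM: if `Λ_E` is injective on the zone `{μ : P (Λ_E μ)}` and `μ ≠ 0` lies in it,
the planar log-coefficient at `Λ_E μ` is `lcoef(μ)·G(μ)`. -/
theorem fibreSum_eq_single {s : ℕ} (E : Fin s → Expo) (hE0 : ∀ i, E i ≠ 0) (P : Expo → Prop)
    (hinj : Set.InjOn (lam E) {μ | P (lam E μ)}) (G : (Fin s → ℕ) → ℂ) (μ : Fin s → ℕ) (hμ : P (lam E μ))
    (hμ0 : μ ≠ 0) :
    (∑ r ∈ Finset.Icc 1 ((lam E μ) 0 + (lam E μ) 1), ∑ k ∈ (Finset.univ : Finset (Fin s)).piAntidiag r,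
        (if lam E k = lam E μ then (-1 : ℂ) ^ (r + 1) / (r : ℂ) * (Nat.multinomial Finset.univ k : ℂ) else 0) * G k)
      = lcoef μ * G μ := by
  classical
  -- every contributing index equals `μ`
  have hfib : ∀ k : Fin s → ℕ, lam E k = lam E μ → k = μ := fun k hk =>
    hinj (show P (lam E k) by rw [hk]; exact hμ) hμ hk
  have hpos : 1 ≤ ∑ i, μ i := by
    obtain ⟨i, hi⟩ : ∃ i, μ i ≠ 0 := by
      by_contra h
      push Not at h
      exact hμ0 (funext h)
    exact le_trans (Nat.one_le_iff_ne_zero.mpr hi)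
      (Finset.single_le_sum (fun j _ => Nat.zero_le (μ j)) (Finset.mem_univ i))
  rw [Finset.sum_eq_single (∑ i, μ i)]
  · rw [Finset.sum_eq_single μ]
    · simp [lcoef]
    · intro k hk hne
      rw [if_neg (fun h => hne (hfib k h)), zero_mul]
    · intro h
      exact absurd (by simp [Finset.mem_piAntidiag]) h
  · intro r _ hr
    refine Finset.sum_eq_zero fun k hk => ?_
    have hks : ∑ i, k i = r := by simpa [Finset.mem_piAntidiag] using hk
    rw [if_neg, zero_mul]
    intro h
    have := hfib k h
    subst this
    exact hr hks.symm
  · intro h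
    exact absurd (Finset.mem_Icc.mpr ⟨hpos, sum_le_deg E hE0 μ⟩) h

-- `logDiff_zero` is `FormalLogLinearisation.logDiff_zero` (EngineCommonConeLattice, imported) — not restated.

/-- **RUNG (SUB₁ below the first coincidence).**  A strict top of `supp D` whose zone `{μ : wt ξ l ≤ wt ξ (Λ_E μ)}` carries
no additive coincidence of the tail support lies in the `2m`-hyperbolic cross: `l = Λ_E μ` with `∏ (μ_i+1) ≤ 2m`.  No
sparsity and no validity of `ξ` are used. -/
theorem planarCross_local (u v : Fin m → MvPolynomial (Fin 2) ℂ)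
    (hu0 : ∀ j, coeff 0 (u j) = 0) (hv0 : ∀ j, coeff 0 (v j) = 0)
    {s : ℕ} (E : Fin s → Expo) (hE : Function.Injective E) (hEr : Set.range E = ↑(tailSupport u v))
    (ξ : Fin 2 → ℝ) (l : Expo) (hl : IsStrictTop ξ (logSupport u v) l)
    (hinj : Set.InjOn (lam E) {μ | wt ξ l ≤ wt ξ (lam E μ)}) :
    ∃ μ : Fin s → ℕ, lam E μ = l ∧ ∏ i, (μ i + 1) ≤ 2 * m := by
  classical
  -- supports inside `range E`, and no `E i` is zero
  have hu : ∀ j, (↑(u j).support : Set Expo) ⊆ Set.range E := fun j e he => by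
    rw [hEr]
    simp only [Finset.mem_coe, tailSupport, Finset.mem_union, Finset.mem_biUnion, Finset.mem_univ, true_and]
    exact Or.inl ⟨j, he⟩
  have hv : ∀ j, (↑(v j).support : Set Expo) ⊆ Set.range E := fun j e he => by
    rw [hEr]
    simp only [Finset.mem_coe, tailSupport, Finset.mem_union, Finset.mem_biUnion, Finset.mem_univ, true_and]
    exact Or.inr ⟨j, he⟩
  have hE0 : ∀ i, E i ≠ 0 := fun i h => by
    have hi : E i ∈ (↑(tailSupport u v) : Set Expo) := by rw [← hEr]; exact ⟨i, rfl⟩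
    simp only [Finset.mem_coe, tailSupport, Finset.mem_union, Finset.mem_biUnion, Finset.mem_univ, true_and,
      mem_support_iff] at hi
    rcases hi with ⟨j, hj⟩ | ⟨j, hj⟩
    · exact hj (by rw [h]; exact hu0 j)
    · exact hj (by rw [h]; exact hv0 j)
  set A : Fin m → Fin s → ℂ := fun j i => coeff (E i) (u j) with hA
  set B : Fin m → Fin s → ℂ := fun j i => coeff (E i) (v j) with hB
  have hF := logDiff_eq_fibreSum E hE u v hu hv
  -- a preimage of `l`
  have hl0 : logDiff u v l ≠ 0 := hl.1
  obtain ⟨μ, hμl⟩ : ∃ μ : Fin s → ℕ, lam E μ = l := by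
    rw [hF l] at hl0
    obtain ⟨r, -, hr⟩ := Finset.exists_ne_zero_of_sum_ne_zero hl0
    obtain ⟨k, -, hk⟩ := Finset.exists_ne_zero_of_sum_ne_zero hr
    by_cases h : lam E k = l
    · exact ⟨k, h⟩
    · simp [h] at hk
  have hμ0 : μ ≠ 0 := by
    rintro rfl
    apply hl0
    rw [← hμl]
    simp [lam, logDiff_zero]
  -- the coefficient at `l` is `lcoef μ · G μ`
  have hzoneμ : wt ξ l ≤ wt ξ (lam E μ) := by rw [hμl]
  have hcoef : logDiff u v l = lcoef μ * umom A B μ := by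
    rw [hF l, ← hμl]
    exact fibreSum_eq_single E hE0 (fun p => wt ξ l ≤ wt ξ p) (by simpa [hμl] using hinj) (umom A B) μ
      (by rw [hμl]) hμ0
  have hGμ : umom A B μ ≠ 0 := fun h => hl0 (by rw [hcoef, h, mul_zero])
  refine ⟨μ, hμl, ?_⟩
  -- hyperbolic cross for the grading `θ_i = −wt ξ (E i)`
  refine unequalMoment_hyperbolicCross A B (fun i => -wt ξ (E i)) μ (sub_ne_zero.mp hGμ) fun ν hne hle => ?_
  have hwt : ∀ k : Fin s → ℕ, ∑ i, -wt ξ (E i) * (k i : ℝ) = -wt ξ (lam E k) := fun k => by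
    rw [wt_lam, ← Finset.sum_neg_distrib]
    exact Finset.sum_congr rfl fun i _ => by ring
  rw [hwt, hwt, neg_le_neg_iff, hμl] at hle
  -- `Λ ν` is in the zone, differs from `l`, hence is not in the support
  have hne' : lam E ν ≠ l := fun h => hne (hinj (show wt ξ l ≤ wt ξ (lam E ν) by rw [h]) hzoneμ (h.trans hμl.symm))
  have hnot : lam E ν ∉ logSupport u v := fun hmem => absurd (hl.2 _ hmem hne') (not_lt.mpr hle)
  have hzero : logDiff u v (lam E ν) = 0 := by
    by_contra h
    exact hnot h
  by_cases hν0 : ν = 0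
  · subst hν0
    exact sub_eq_zero.mp (umom_zero A B)
  · have hc : logDiff u v (lam E ν) = lcoef ν * umom A B ν := by
      rw [hF (lam E ν)]
      exact fibreSum_eq_single E hE0 (fun p => wt ξ l ≤ wt ξ p) hinj (umom A B) ν hle hν0
    rw [hzero] at hc
    have := (mul_eq_zero.mp hc.symm).resolve_left (lcoef_ne_zero ν hν0)
    exact sub_eq_zero.mp this




/-- The signed `2m`-term exponential sum of the two coefficient configurations is the unequal-moment function. -/
theorem expSum_elim_eq_umom {s : ℕ} (A B : Fin m → Fin s → ℂ) (ν : Fin s → ℕ) :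
    (∑ k, (Sum.elim (fun _ => (1 : ℂ)) (fun _ => -1) k) * ∏ i, (Sum.elim A B k) i ^ ν i) = umom A B ν := by
  rw [Fintype.sum_sum_type]
  simp only [umom, Sum.elim_inl, Sum.elim_inr, one_mul, neg_mul, Finset.sum_neg_distrib]
  ring

end Summit.ValiantsHypothesis.ValiantsHypothesis.Theorems.NewtonUnitEquations.TwoProducts.PlanarCellRung

end
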